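import Mathlib.RingTheory.PowerSeries.Derivative
import Mathlib.RingTheory.PowerSeries.Order
import Mathlib.RingTheory.PowerSeries.Inverse
import Mathlib.LinearAlgebra.Dimension.Finite
import Mathlib.LinearAlgebra.Dimension.Finrank
import Mathlib.LinearAlgebra.FiniteDimensional.Lemmas
import Mathlib.Algebra.BigOperators.NatAntidiagonal
import Mathlib.Tactic
import HarnessLib

/-!
# Formal linear differential systems: the dimension bound and the fundamental matrix

Two basic facts about systems of homogeneous linear differential equations
`w' = q w` for vectors `w` of formal power series over a field `K` of characteristic zero, in the
form in which they enter Shidlovsky's lemma (K. Mahler, *Lectures on transcendental numbers*,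
LNM 546, Ch. 3 §§44–49 [Mahler1976]; CDT [CalegariDimitrovTang2024, §3.2 Theorem 37] quote
Shidlovsky's lemma as the "functional bad approximability" input of their fine holonomy bound):

* `FormalODE.solSpace_not_linearIndependent`, `FormalODE.finrank_solSpace_le` — Mahler's
  lemma (2) (§45, p. 58): **the solutions in `K⟦X⟧ⁿ` of an `n × n` system `κ w' = U w`
  (`κ ∈ K⟦X⟧ ∖ 0`, `U ∈ Mₙ(K⟦X⟧)`; singular points allowed) form a `K`-vector space of
  dimension at most `n`** — any `n + 1` solutions are `K`-linearly dependent. Proof: a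
  `K⟦X⟧`-dependence of minimal support is proportional to its derivative, hence has constant
  ratios (`FormalODE.eq_smul_of_derivative_mul_eq`: `g′f = f′g ⇒ g = c·f`).
* `FormalODE.fundMatrix` — Mahler's §§48–49 (pp. 60–61): **at a regular point the system
  `w' = q w` (`q ∈ M_m(K⟦X⟧)`) has a fundamental matrix of formal power series solutions**
  `v = 1 + Σ_{l ≥ 1} q_[l] X^l` with `v′ = q v`, `v(0) = 1` (`map_derivative_fundMatrix`,
  `map_constantCoeff_fundMatrix`); every solution is `v · w(0)` (`eq_fundMatrix_mulVec`), so the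
  solution space has dimension exactly `m` (`finrank_solSpace_one`).

## References
* [Mahler1976] K. Mahler, *Lectures on transcendental numbers*, Lecture Notes in Math. 546,
  Springer 1976, Ch. 3 §§44–49.
* [CalegariDimitrovTang2024] F. Calegari, V. Dimitrov, Y. Tang, arXiv:2408.15403, §3.2 Thm 37.
-/

namespace Literature.NumberTheory.Transcendental

namespace FormalODE

open PowerSeries Finset

noncomputable section

variable {K : Type*} [Field K] [CharZero K]

/-! ### Constancy lemmas for the formal derivative -/

/-- If `X · v′ = e · v` then `v` is the monomial `v_e X^e`. [folklore] -/
theorem eq_smul_X_pow_of_X_mul_derivative {v : K⟦X⟧} {e : ℕ}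
    (h : X * derivative K v = (e : K⟦X⟧) * v) : v = coeff e v • X ^ e := by
  have hcoeff : ∀ n : ℕ, (n : K) * coeff n v = (e : K) * coeff n v := by
    intro n
    have hn := congrArg (coeff n) h
    rw [show ((e : K⟦X⟧)) = C (e : K) by simp, coeff_C_mul] at hn
    rcases n with _ | n
    · rw [coeff_zero_X_mul] at hn
      simpa using hn
    · rw [coeff_succ_X_mul, coeff_derivative] at hn
      push_cast at hn ⊢
      linear_combination hn
  ext n
  rw [coeff_smul, coeff_X_pow]
  split_ifs with hne
  · subst hne; simp
  · have h1 := hcoeff n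
    have hne' : ((n : K) - e) ≠ 0 := by
      rw [sub_ne_zero]; exact_mod_cast hne
    have : ((n : K) - e) * coeff n v = 0 := by linear_combination h1
    rcases mul_eq_zero.mp this with h | h
    · exact absurd h hne'
    · simp [h]

/-- **`g′ f = f′ g` forces `g = c · f`** (`f ≠ 0`) in `K⟦X⟧`, `char K = 0`: the quotient of two
series with vanishing Wronskian is constant. [cite: Mahler1976, Ch. 3 §45 (proof of lemma (2))] -/
theorem eq_smul_of_derivative_mul_eq {f g : K⟦X⟧} (hf : f ≠ 0)
    (h : derivative K g * f = derivative K f * g) : ∃ c : K, g = c • f := by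
  -- `f = X^e u` with `u` a unit
  set e := f.order.toNat with he
  obtain ⟨u₀, hu⟩ := X_pow_order_dvd (φ := f)
  rw [← he] at hu
  have hu0 : constantCoeff u₀ ≠ 0 := by
    have := coeff_order hf
    rw [← he, hu, coeff_X_pow_mul', if_pos le_rfl, Nat.sub_self, coeff_zero_eq_constantCoeff] at this
    exact this
  have hunit : IsUnit u₀ := isUnit_iff_constantCoeff.mpr (isUnit_iff_ne_zero.mpr hu0)
  obtain ⟨ũ, rfl⟩ := hunit
  set u : K⟦X⟧ := ↑ũ with hu'
  set w : K⟦X⟧ := ↑ũ⁻¹ with hw'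
  have huw : u * w = 1 := by rw [hu', hw']; exact ũ.mul_inv
  have hdw : derivative K w = -w ^ 2 * derivative K u := by rw [hw', hu']; exact derivative_inv ũ
  set v : K⟦X⟧ := g * w with hv
  have hg : g = v * u := by rw [hv, mul_assoc, mul_comm w, huw, mul_one]
  -- the identity `X^e v′ = e X^{e-1} v`
  have hXe : derivative K ((X : K⟦X⟧) ^ e) = (e : K⟦X⟧) * X ^ (e - 1) := by
    rw [derivative_pow, derivative_X, mul_one]
  have h' : derivative K g * (X ^ e * u) = ((e : K⟦X⟧) * X ^ (e - 1) * u + X ^ e * derivative K u) * g := by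
    have hdf : derivative K f = (e : K⟦X⟧) * X ^ (e - 1) * u + X ^ e * derivative K u := by
      rw [hu, Derivation.leibniz, hXe, smul_eq_mul, smul_eq_mul]; ring
    rw [← hdf, ← hu]; exact h
  have hdv : derivative K v = derivative K g * w + g * derivative K w := by
    rw [hv, Derivation.leibniz, smul_eq_mul, smul_eq_mul]; ring
  have key' : X ^ e * derivative K v = (e : K⟦X⟧) * X ^ (e - 1) * v := by
    rw [hdv, hdw, hv]
    linear_combination w ^ 2 * h' - (X ^ e * derivative K g * w - (e : K⟦X⟧) * X ^ (e - 1) * g * w) * huw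
  -- deduce `X v′ = e v`
  have hXv : X * derivative K v = (e : K⟦X⟧) * v := by
    rcases Nat.eq_zero_or_pos e with h0 | hpos
    · rw [h0] at key'
      simp only [pow_zero, one_mul, Nat.cast_zero, zero_mul] at key'
      rw [key', h0, Nat.cast_zero, zero_mul, mul_zero]
    · obtain ⟨k, hk⟩ : ∃ k, e = k + 1 := ⟨e - 1, by omega⟩
      rw [hk, Nat.add_sub_cancel, pow_succ] at key'
      have hXk : (X : K⟦X⟧) ^ k ≠ 0 := pow_ne_zero _ X_ne_zero
      apply mul_left_cancel₀ hXk
      rw [hk]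
      linear_combination key'
  have hv' := eq_smul_X_pow_of_X_mul_derivative hXv
  refine ⟨coeff e v, ?_⟩
  calc g = v * u := hg
    _ = (coeff e v • X ^ e) * u := by nth_rw 1 [hv']
    _ = coeff e v • f := by rw [hu, smul_mul_assoc]

/-! ### Mahler's lemma (2): at most `n` independent solutions -/

variable {n : ℕ}

/-- The `K`-vector space of solutions `w ∈ K⟦X⟧ⁿ` of the system `κ wᵢ′ = Σⱼ Uᵢⱼ wⱼ`.
[cite: Mahler1976, Ch. 3 §44 (`V_Q`)] -/
def solSpace (κ : K⟦X⟧) (U : Matrix (Fin n) (Fin n) K⟦X⟧) : Submodule K (Fin n → K⟦X⟧) where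
  carrier := {w | ∀ i, κ * derivative K (w i) = ∑ j, U i j * w j}
  add_mem' := by
    intro a b ha hb i
    simp only [Pi.add_apply, map_add, mul_add, ha i, hb i, ← Finset.sum_add_distrib]
  zero_mem' := by intro i; simp
  smul_mem' := by
    intro c w hw i
    simp only [Pi.smul_apply, smul_eq_C_mul]
    rw [Derivation.leibniz, derivative_C, smul_zero, add_zero, smul_eq_mul, ← mul_assoc, mul_comm κ,
      mul_assoc, hw i, Finset.mul_sum]
    refine Finset.sum_congr rfl fun j _ => ?_
    ring

omit [CharZero K] in
/-- Membership in the solution space. [folklore] -/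
theorem mem_solSpace {κ : K⟦X⟧} {U : Matrix (Fin n) (Fin n) K⟦X⟧} {w : Fin n → K⟦X⟧} :
    w ∈ solSpace κ U ↔ ∀ i, κ * derivative K (w i) = ∑ j, U i j * w j := Iff.rfl

omit [CharZero K] in
/-- A `K⟦X⟧`-linear relation among solutions is again a relation after applying `κ d/dX` to its
coefficients. [cite: Mahler1976, Ch. 3 §45] -/
theorem relation_derivative {κ : K⟦X⟧} {U : Matrix (Fin n) (Fin n) K⟦X⟧} {ι : Type*} [Fintype ι]
    {w : ι → Fin n → K⟦X⟧} (hw : ∀ k, w k ∈ solSpace κ U) {a : ι → K⟦X⟧}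
    (ha : ∑ k, a k • w k = 0) : ∑ k, (κ * derivative K (a k)) • w k = 0 := by
  funext i
  have hi : ∑ k, a k * w k i = 0 := by
    have := congrFun ha i
    simpa [Finset.sum_apply, Pi.smul_apply, smul_eq_mul] using this
  have hder := congrArg (fun s => κ * derivative K s) hi
  simp only [map_sum, map_zero, mul_zero, Finset.mul_sum] at hder
  -- `κ (a_k w_ki)' = κ a_k' w_ki + a_k (κ w_ki')`
  have hsplit : ∑ k, κ * derivative K (a k * w k i) =
      ∑ k, κ * derivative K (a k) * w k i + ∑ k, a k * ∑ j, U i j * w k j := by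
    rw [← Finset.sum_add_distrib]
    refine Finset.sum_congr rfl fun k _ => ?_
    rw [Derivation.leibniz, smul_eq_mul, smul_eq_mul, ← (hw k) i]
    ring
  have hU : ∑ k, a k * ∑ j, U i j * w k j = ∑ j, U i j * ∑ k, a k * w k j := by
    simp_rw [Finset.mul_sum]
    rw [Finset.sum_comm]
    refine Finset.sum_congr rfl fun j _ => Finset.sum_congr rfl fun k _ => by ring
  have hzero : ∀ j, ∑ k, a k * w k j = 0 := by
    intro j
    have := congrFun ha j
    simpa [Finset.sum_apply, Pi.smul_apply, smul_eq_mul] using this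
  rw [hsplit, hU] at hder
  simp only [hzero, mul_zero, Finset.sum_const_zero, add_zero] at hder
  simpa [Finset.sum_apply, Pi.smul_apply, smul_eq_mul] using hder

/-- **Mahler's lemma (2)**: any `n + 1` solutions in `K⟦X⟧ⁿ` of `κ w′ = U w` (`κ ≠ 0`) are
`K`-linearly dependent. [cite: Mahler1976, Ch. 3 §45 lemma (2) (p. 58)] -/
theorem solSpace_not_linearIndependent {κ : K⟦X⟧} (hκ : κ ≠ 0) {U : Matrix (Fin n) (Fin n) K⟦X⟧}
    (w : Fin (n + 1) → Fin n → K⟦X⟧) (hw : ∀ k, w k ∈ solSpace κ U) : ¬ LinearIndependent K w := by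
  classical
  -- Step 1: a `K⟦X⟧`-dependence
  have hdep : ¬ LinearIndependent K⟦X⟧ w := by
    intro hli
    have h := hli.fintype_card_le_finrank
    rw [Module.finrank_fintype_fun_eq_card, Fintype.card_fin, Fintype.card_fin] at h
    omega
  -- Step 2: a dependence of minimal support
  let P : ℕ → Prop := fun s => ∃ a : Fin (n + 1) → K⟦X⟧, ∑ k, a k • w k = 0 ∧ a ≠ 0 ∧
    (Finset.univ.filter fun k => a k ≠ 0).card = s
  have hP : ∃ s, P s := by
    obtain ⟨a, ha, k, hk⟩ := Fintype.not_linearIndependent_iff.mp hdep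
    exact ⟨_, a, ha, fun h => hk (by rw [h]; rfl), rfl⟩
  obtain ⟨a, ha, ha0, hcard⟩ := Nat.find_spec hP
  have hmin : ∀ b : Fin (n + 1) → K⟦X⟧, ∑ k, b k • w k = 0 → b ≠ 0 →
      (Finset.univ.filter fun k => a k ≠ 0).card ≤ (Finset.univ.filter fun k => b k ≠ 0).card := by
    intro b hb hb0
    rw [hcard]
    exact Nat.find_min' hP ⟨b, hb, hb0, rfl⟩
  obtain ⟨k₀, hk₀⟩ : ∃ k₀, a k₀ ≠ 0 := by
    by_contra h; push Not at h; exact ha0 (funext h)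
  -- Step 3/4: the combination `a k₀ · (κ a′) − (κ a′ k₀) · a` has smaller support, hence vanishes
  set b : Fin (n + 1) → K⟦X⟧ := fun k => κ * derivative K (a k) with hb
  have hbrel : ∑ k, b k • w k = 0 := relation_derivative hw ha
  set c : Fin (n + 1) → K⟦X⟧ := fun k => a k₀ * b k - b k₀ * a k with hc
  have hcrel : ∑ k, c k • w k = 0 := by
    have : ∑ k, c k • w k = a k₀ • ∑ k, b k • w k - b k₀ • ∑ k, a k • w k := by
      rw [Finset.smul_sum, Finset.smul_sum, ← Finset.sum_sub_distrib]
      refine Finset.sum_congr rfl fun k _ => ?_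
      rw [hc, sub_smul, smul_smul, smul_smul]
    rw [this, hbrel, ha, smul_zero, smul_zero, sub_zero]
  have hc0 : c = 0 := by
    by_contra hne
    have hle := hmin c hcrel hne
    have hsub : (Finset.univ.filter fun k => c k ≠ 0) ⊂ (Finset.univ.filter fun k => a k ≠ 0) := by
      rw [Finset.ssubset_iff_subset_ne]
      constructor
      · intro k hk
        rw [Finset.mem_filter] at hk ⊢
        refine ⟨hk.1, fun hak => hk.2 ?_⟩
        rw [hc]; simp only
        rw [hak, mul_zero, sub_zero, hb]; simp only
        rw [hak, map_zero, mul_zero, mul_zero]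
      · intro heq
        have : k₀ ∈ (Finset.univ.filter fun k => c k ≠ 0) := by
          rw [heq]; exact Finset.mem_filter.mpr ⟨Finset.mem_univ _, hk₀⟩
        rw [Finset.mem_filter] at this
        apply this.2
        rw [hc]; simp only; ring
    exact absurd (Finset.card_lt_card hsub) (not_lt.mpr hle)
  -- Step 5: all `a k` are constant multiples of `a k₀`
  have hprop : ∀ k, ∃ t : K, a k = t • a k₀ := by
    intro k
    have hck : c k = 0 := congrFun hc0 k
    rw [hc] at hck
    simp only [hb] at hck
    -- `a k₀ * (κ * a k') = κ * a k₀' * a k`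
    have h1 : κ * (derivative K (a k) * a k₀) = κ * (derivative K (a k₀) * a k) := by
      linear_combination hck
    exact eq_smul_of_derivative_mul_eq hk₀ (mul_left_cancel₀ hκ h1)
  choose t ht using hprop
  -- Step 6: the constant relation
  rw [Fintype.not_linearIndependent_iff]
  refine ⟨t, ?_, k₀, ?_⟩
  · have hsum : a k₀ • ∑ k, t k • w k = ∑ k, a k • w k := by
      rw [Finset.smul_sum]
      refine Finset.sum_congr rfl fun k _ => ?_
      rw [ht k, smul_assoc, smul_comm (t k) (a k₀) (w k)]
    rw [ha] at hsum
    exact (smul_eq_zero.mp hsum).resolve_left hk₀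
  · intro ht0
    have := ht k₀
    rw [ht0, zero_smul] at this
    exact hk₀ this

/-- The solution space of `κ w′ = U w` in `K⟦X⟧ⁿ` has dimension at most `n`.
[cite: Mahler1976, Ch. 3 §45 lemma (2); §47 eq. (2)] -/
theorem finrank_solSpace_le {κ : K⟦X⟧} (hκ : κ ≠ 0) (U : Matrix (Fin n) (Fin n) K⟦X⟧) :
    Module.finrank K (solSpace κ U) ≤ n := by
  classical
  apply Module.finrank_le_of_rank_le
  apply rank_le
  intro s hs
  by_contra hlt
  push Not at hlt
  -- extract `n + 1` independent solutions
  have hli : LinearIndependent K (fun i : s => ((i : solSpace κ U) : Fin n → K⟦X⟧)) :=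
    hs.map' (solSpace κ U).subtype (Submodule.ker_subtype _)
  have hle : n + 1 ≤ s.card := hlt
  let ι : Fin (n + 1) → s := fun k => s.equivFin.symm (Fin.castLE hle k)
  have hι : Function.Injective ι := fun a b hab => by
    have := s.equivFin.symm.injective hab
    exact Fin.castLE_injective hle this
  have hli' := hli.comp ι hι
  exact solSpace_not_linearIndependent hκ _ (fun k => ((ι k : s) : solSpace κ U).2) hli'

/-! ### The fundamental matrix at a regular point (Mahler §§48–49) -/

variable {m : ℕ}

/-- The Taylor coefficient matrices `q_[l]` of the fundamental solution: `q_[0] = 1`,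
`(l+1) q_[l+1] = Σ_{k ≤ l} q_(k) q_[l−k]`. [cite: Mahler1976, Ch. 3 §48 (p. 60)] -/
def fundCoeff (Q : ℕ → Matrix (Fin m) (Fin m) K) : ℕ → Matrix (Fin m) (Fin m) K
  | 0 => 1
  | l + 1 => ((l : K) + 1)⁻¹ • ∑ k : Fin (l + 1), Q k * fundCoeff Q (l - k)
  decreasing_by omega

omit [CharZero K] in
/-- `q_[0] = 1`. [cite: Mahler1976, Ch. 3 §48] -/
theorem fundCoeff_zero (Q : ℕ → Matrix (Fin m) (Fin m) K) : fundCoeff Q 0 = 1 := by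
  rw [fundCoeff]

/-- The recursion `(l+1) q_[l+1] = Σ_{k ≤ l} q_(k) q_[l−k]`. [cite: Mahler1976, Ch. 3 §48] -/
theorem fundCoeff_succ (Q : ℕ → Matrix (Fin m) (Fin m) K) (l : ℕ) :
    ((l : K) + 1) • fundCoeff Q (l + 1) = ∑ k ∈ Finset.range (l + 1), Q k * fundCoeff Q (l - k) := by
  rw [fundCoeff, smul_smul, mul_inv_cancel₀ (by exact_mod_cast Nat.succ_ne_zero l), one_smul,
    ← Fin.sum_univ_eq_sum_range (fun k => Q k * fundCoeff Q (l - k))]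

/-- The Taylor coefficient matrices `q_(k)` of a matrix of power series. [folklore] -/
def coeffMatrix (q : Matrix (Fin m) (Fin m) K⟦X⟧) (k : ℕ) : Matrix (Fin m) (Fin m) K :=
  q.map (PowerSeries.coeff (R := K) k)

omit [CharZero K] in
/-- Entries of the coefficient matrices. [folklore] -/
theorem coeffMatrix_apply (q : Matrix (Fin m) (Fin m) K⟦X⟧) (k : ℕ) (i j : Fin m) :
    coeffMatrix q k i j = coeff k (q i j) := rfl

/-- **The fundamental matrix** `v = Σ_l q_[l] X^l` of the regular system `w′ = q w`,
`q ∈ M_m(K⟦X⟧)`. [cite: Mahler1976, Ch. 3 §48 (p. 60)] -/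
def fundMatrix (q : Matrix (Fin m) (Fin m) K⟦X⟧) : Matrix (Fin m) (Fin m) K⟦X⟧ :=
  fun i j => PowerSeries.mk fun l => fundCoeff (coeffMatrix q) l i j

omit [CharZero K] in
/-- Coefficients of the fundamental matrix. [folklore] -/
theorem coeff_fundMatrix (q : Matrix (Fin m) (Fin m) K⟦X⟧) (l : ℕ) (i j : Fin m) :
    coeff l (fundMatrix q i j) = fundCoeff (coeffMatrix q) l i j := by
  rw [fundMatrix, coeff_mk]

omit [CharZero K] in
/-- `v(0) = 1`. [cite: Mahler1976, Ch. 3 §48] -/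
theorem map_constantCoeff_fundMatrix (q : Matrix (Fin m) (Fin m) K⟦X⟧) :
    (fundMatrix q).map constantCoeff = 1 := by
  ext i j
  rw [Matrix.map_apply, ← coeff_zero_eq_constantCoeff_apply, coeff_fundMatrix, fundCoeff_zero]

omit [CharZero K] in
/-- The coefficient identity behind `v′ = q v`: `coeff_l (Σ_r q_ir v_rj) = (Σ_{k ≤ l} q_(k) q_[l−k])_ij`.
[folklore] -/
theorem coeff_mul_fundMatrix (q : Matrix (Fin m) (Fin m) K⟦X⟧) (l : ℕ) (i j : Fin m) :
    coeff l ((q * fundMatrix q) i j) =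
      (∑ k ∈ Finset.range (l + 1), coeffMatrix q k * fundCoeff (coeffMatrix q) (l - k)) i j := by
  have hL : ∀ r, coeff l (q i r * fundMatrix q r j) =
      ∑ k ∈ Finset.range (l + 1), coeff k (q i r) * fundCoeff (coeffMatrix q) (l - k) r j := by
    intro r
    rw [coeff_mul, Finset.Nat.sum_antidiagonal_eq_sum_range_succ
      (fun a b => coeff a (q i r) * coeff b (fundMatrix q r j)) l]
    exact Finset.sum_congr rfl fun k _ => by rw [coeff_fundMatrix]
  rw [Matrix.mul_apply, map_sum]
  simp_rw [hL]
  rw [Matrix.sum_apply, Finset.sum_comm]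
  refine Finset.sum_congr rfl fun k _ => ?_
  rw [Matrix.mul_apply]
  refine Finset.sum_congr rfl fun r _ => ?_
  rw [coeffMatrix_apply]

/-- **`v′ = q v`** for the fundamental matrix. [cite: Mahler1976, Ch. 3 §48 (p. 60)] -/
theorem map_derivative_fundMatrix (q : Matrix (Fin m) (Fin m) K⟦X⟧) :
    (fundMatrix q).map (derivative K) = q * fundMatrix q := by
  ext i j l
  rw [Matrix.map_apply]
  rw [coeff_derivative (R := K) (fundMatrix q i j) l]
  rw [coeff_fundMatrix, coeff_mul_fundMatrix]
  have h := fundCoeff_succ (coeffMatrix q) l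
  have hij := congrFun (congrFun h i) j
  rw [Matrix.smul_apply, smul_eq_mul] at hij
  rw [mul_comm, hij]

/-- The columns of the fundamental matrix, and all their constant combinations `v · c`, solve
`w′ = q w`. [cite: Mahler1976, Ch. 3 §49] -/
theorem fundMatrix_mulVec_mem_solSpace (q : Matrix (Fin m) (Fin m) K⟦X⟧) (c : Fin m → K) :
    (fundMatrix q).mulVec (fun j => C (c j)) ∈ solSpace 1 q := by
  intro i
  rw [one_mul, Matrix.mulVec, dotProduct, map_sum]
  have hd : ∀ j, derivative K (fundMatrix q i j * C (c j)) = (q * fundMatrix q) i j * C (c j) := by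
    intro j
    rw [Derivation.leibniz, derivative_C, smul_zero, zero_add, smul_eq_mul, mul_comm,
      ← map_derivative_fundMatrix, Matrix.map_apply]
  simp_rw [hd, Matrix.mul_apply, Finset.sum_mul]
  rw [Finset.sum_comm]
  refine Finset.sum_congr rfl fun r _ => ?_
  rw [Matrix.mulVec, dotProduct, Finset.mul_sum]
  refine Finset.sum_congr rfl fun j _ => by ring

/-- Uniqueness: a solution of the regular system `w′ = q w` with vanishing constant part is zero.
[cite: Mahler1976, Ch. 3 §48 ("exactly one solution with the given constant part")] -/
theorem eq_zero_of_constantCoeff_eq_zero (q : Matrix (Fin m) (Fin m) K⟦X⟧) {w : Fin m → K⟦X⟧}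
    (hw : w ∈ solSpace 1 q) (h0 : ∀ i, constantCoeff (w i) = 0) : w = 0 := by
  have hcoeff : ∀ l, ∀ i, coeff l (w i) = 0 := by
    intro l
    induction l using Nat.strong_induction_on with
    | _ l ih =>
      intro i
      rcases l with _ | l
      · rw [coeff_zero_eq_constantCoeff]; exact h0 i
      · have h := congrArg (coeff l) ((hw) i)
        rw [one_mul, coeff_derivative, map_sum] at h
        have hrhs : ∑ j, coeff l (q i j * w j) = 0 := by
          refine Finset.sum_eq_zero fun j _ => ?_
          rw [coeff_mul]
          refine Finset.sum_eq_zero fun p hp => ?_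
          have hp2 : p.2 ≤ l := by
            have := Finset.mem_antidiagonal.mp hp; omega
          rw [ih p.2 (Nat.lt_succ_of_le hp2) j, mul_zero]
        rw [hrhs] at h
        have hl : ((l : K) + 1) ≠ 0 := by exact_mod_cast Nat.succ_ne_zero l
        exact (mul_eq_zero.mp h).resolve_right hl
  funext i
  exact PowerSeries.ext fun l => by rw [hcoeff l i]; rfl

/-- **Every solution of the regular system is `v · w(0)`.** [cite: Mahler1976, Ch. 3 §48
("this solution has the explicit form `w = v w_(0)`")] -/
theorem eq_fundMatrix_mulVec (q : Matrix (Fin m) (Fin m) K⟦X⟧) {w : Fin m → K⟦X⟧}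
    (hw : w ∈ solSpace 1 q) :
    w = (fundMatrix q).mulVec (fun j => C (constantCoeff (w j))) := by
  have hdiff : w - (fundMatrix q).mulVec (fun j => C (constantCoeff (w j))) ∈ solSpace 1 q :=
    (solSpace 1 q).sub_mem hw (fundMatrix_mulVec_mem_solSpace q _)
  have h0 : ∀ i, constantCoeff ((w - (fundMatrix q).mulVec (fun j => C (constantCoeff (w j)))) i) = 0 := by
    intro i
    rw [Pi.sub_apply, map_sub, Matrix.mulVec, dotProduct, map_sum]
    have : ∀ j, constantCoeff (fundMatrix q i j * C (constantCoeff (w j))) =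
        (1 : Matrix (Fin m) (Fin m) K) i j * constantCoeff (w j) := by
      intro j
      rw [map_mul, constantCoeff_C, ← map_constantCoeff_fundMatrix q, Matrix.map_apply]
    simp_rw [this, Matrix.one_apply, ite_mul, one_mul, zero_mul, Finset.sum_ite_eq, Finset.mem_univ,
      if_true, sub_self]
  have := eq_zero_of_constantCoeff_eq_zero q hdiff h0
  exact sub_eq_zero.mp this

/-- The solution space of the regular system `w′ = q w` is `K`-isomorphic to `Kᵐ` via the constant
part. [cite: Mahler1976, Ch. 3 §49 (4): "When Q is regular, V_Q has dimension m over K"] -/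
def solEquiv (q : Matrix (Fin m) (Fin m) K⟦X⟧) : (Fin m → K) ≃ₗ[K] solSpace 1 q where
  toFun c := ⟨(fundMatrix q).mulVec (fun j => C (c j)), fundMatrix_mulVec_mem_solSpace q c⟩
  map_add' a b := by
    apply Subtype.ext
    simp only [Pi.add_apply, map_add, Submodule.coe_add]
    rw [← Matrix.mulVec_add]; rfl
  map_smul' r c := by
    apply Subtype.ext
    simp only [Pi.smul_apply, smul_eq_mul, RingHom.id_apply, Submodule.coe_smul]
    funext i
    simp only [Matrix.mulVec, dotProduct, Pi.smul_apply, smul_eq_C_mul, Finset.mul_sum, map_mul]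
    refine Finset.sum_congr rfl fun j _ => by ring
  invFun w := fun j => constantCoeff ((w : Fin m → K⟦X⟧) j)
  left_inv c := by
    funext j
    simp only
    rw [Matrix.mulVec, dotProduct, map_sum]
    have : ∀ r, constantCoeff (fundMatrix q j r * C (c r)) = (1 : Matrix (Fin m) (Fin m) K) j r * c r := by
      intro r
      rw [map_mul, constantCoeff_C, ← map_constantCoeff_fundMatrix q, Matrix.map_apply]
    simp_rw [this, Matrix.one_apply, ite_mul, one_mul, zero_mul, Finset.sum_ite_eq, Finset.mem_univ,
      if_true]
  right_inv w := by
    apply Subtype.ext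
    exact (eq_fundMatrix_mulVec q w.2).symm

/-- **At a regular point the solution space has dimension exactly `m`.**
[cite: Mahler1976, Ch. 3 §49 (4)] -/
theorem finrank_solSpace_one (q : Matrix (Fin m) (Fin m) K⟦X⟧) :
    Module.finrank K (solSpace 1 q) = m := by
  rw [← LinearEquiv.finrank_eq (solEquiv q), Module.finrank_fintype_fun_eq_card, Fintype.card_fin]

end

end FormalODE

end Literature.NumberTheory.Transcendental
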